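import Literature.Probability.Percolation.FullPlaneCNL
import Literature.Probability.Percolation.CLE6Proofs
import Literature.Probability.LatticeModels.TriangularLatticeProofs
import HarnessLib

/-!
# Full-plane CNL laws: locality of `d_CN` and the domain form of `IsFullPlaneCNLLaw`

Companion (proofs only: no definitions, no named facts) to `FullPlaneCNL.lean`, whose named fact
`exists_isFullPlaneCNLLaw` (F. Camia, C. M. Newman, Comm. Math. Phys. 268 (2006), Thms 1 and 6:
existence of the full-plane Continuum Nonsimple Loop law, rendered in DKKMO's coupling distance
`d_CN`) is the eventual target. This file proves the first step of the printed proof of Thm 6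
(CMP 268, §6, "Proof of Theorem 6", first paragraph: couple the configurations in `𝔻_R ⊂ 𝔻_{R'}`
so that they agree on `𝔻_R`; then "the boundaries [...] contained inside `D` are identical for
all small enough `δ`", so the laws seen inside `D` do not depend on `R`) in the tree's encoding:

* `LoopConfig.isClose_congr_left` — **locality of the printed relation `d_CN(F, F') ≤ ε`**
  (DKKMO, arXiv:2012.11672v2, §1.2): it only depends on the members of `F` lying in the window
  `B(0, 1/ε + ε)` (a partner of a loop inside `B(0, 1/ε)` at `d`-distance `≤ ε` lies inside
  `B(0, 1/ε + ε)`, `UnbasedLoop.range_subset_ball_of_udist_le`).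
* `isSiteInterfaceLoop_inter_triMeshVertices_iff`, `mem_siteLoopConfig_inter_iff` — **whole-plane
  versus restricted configuration**: an interface loop drawn at mesh `δ` inside `B(0, r)` only
  reads sites whose mesh points lie in `B(0, r + δ)` (the open site on the left and the closed
  site on the right of each dart are within `δ` of a vertex of the polygon,
  `hexCenter_triEdgeFaces_mem_closedBall`, `triEdgeFaces_symm_holds`), so for `Ω ⊇ B(0, r + δ)`
  the typed loops inside `B(0, r)` of `ω` and of the restricted configuration
  `ω ∩ triMeshVertices Ω δ` of `CLE6.lean` (sites outside `Ω` closed: the closed boundary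
  condition of `triLoopCollection`) coincide.
* `isClose_siteLoopConfig_inter_iff` — hence `d_CN(siteLoopConfig δ ω, F') ≤ ε` is unchanged when
  `ω` is restricted to any `Ω ⊇ B(0, 1/ε + ε + δ)`;
* `isFullPlaneCNLLaw_iff_inter` — **domain form of `IsFullPlaneCNLLaw`**: the law of `X` is a
  full-plane CNL law iff for every `ε > 0`, for all small `δ > 0`, the critical site configuration
  *restricted to the disc* `B(0, 1/ε + ε + 1)` couples to `X` with `d_CN ≤ ε` off an event of
  probability `< ε`. This is the interface through which the domain scaling limit
  (`exists_isCNLFamily_tendsto`, `CLE6.lean`) enters the full-plane statement.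

Not here: the fact `exists_isFullPlaneCNLLaw` itself (it needs the Camia–Newman scaling limit in
domains, the thermodynamic limit with Kolmogorov's extension theorem, a typed (orientation)
transfer and a coupling form of weak convergence; see the module docstring of `FullPlaneCNL.lean`).

## References

* F. Camia, C. M. Newman, Comm. Math. Phys. 268 (2006) 1–38, §6, proof of Thm 6
  [CamiaNewman2006].
* H. Duminil-Copin, K. K. Kozlowski, D. Krachun, I. Manolescu, M. Oulamara, arXiv:2012.11672v2,
  §1.2, eq. (1)–(2) [arXiv201211672v2].
-/

noncomputable section

open Set Filter MeasureTheory Metric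
open scoped Topology ENNReal unitInterval

namespace Literature.Probability.Percolation

open LatticeModels RandomPlanarGeometry

/-! ### Locality of `d_CN ≤ ε` in the first configuration -/

/-- One-sided form of `LoopConfig.isClose_congr_left`. [cite: arXiv201211672v2, §1.2] -/
theorem _root_.Literature.Probability.RandomPlanarGeometry.LoopConfig.IsClose.of_forall_mem_iff
    {E : Type*} [NormedAddCommGroup E] {ε : ℝ} (hε : 0 ≤ ε) {c₁ c₂ c' : LoopConfig E}
    (h : ∀ (i : Fin 2) (u : UnbasedLoop E), u.range ⊆ ball (0 : E) (1 / ε + ε) →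
      (u ∈ c₁.F i ↔ u ∈ c₂.F i))
    (hc : LoopConfig.IsClose ε c₁ c') : LoopConfig.IsClose ε c₂ c' := by
  have hball : ball (0 : E) (1 / ε) ⊆ ball 0 (1 / ε + ε) :=
    ball_subset_ball (le_add_of_nonneg_right hε)
  intro i
  refine ⟨fun u hu hr ↦ (hc i).1 u ((h i u (hr.trans hball)).2 hu) hr, fun u' hu' hr ↦ ?_⟩
  obtain ⟨u, hu, hd⟩ := (hc i).2 u' hu' hr
  exact ⟨u, (h i u (UnbasedLoop.range_subset_ball_of_udist_le hr hd)).1 hu, hd⟩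

/-- **Locality of the printed relation `d_CN(F, F') ≤ ε`** (DKKMO, arXiv:2012.11672v2, §1.2) in
its first argument: if two configurations `F₁`, `F₂` have the same members of each type inside the
window `B(0, 1/ε + ε)`, then `d_CN(F₁, F') ≤ ε ↔ d_CN(F₂, F') ≤ ε`. Indeed the relation quantifies
over the members of `F` inside `B(0, 1/ε)` and over the partners in `F` of members of `F'` inside
`B(0, 1/ε)`, which lie inside `B(0, 1/ε + ε)` (`UnbasedLoop.range_subset_ball_of_udist_le`).
[cite: arXiv201211672v2, §1.2] -/
theorem _root_.Literature.Probability.RandomPlanarGeometry.LoopConfig.isClose_congr_left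
    {E : Type*} [NormedAddCommGroup E] {ε : ℝ} (hε : 0 ≤ ε) {c₁ c₂ c' : LoopConfig E}
    (h : ∀ (i : Fin 2) (u : UnbasedLoop E), u.range ⊆ ball (0 : E) (1 / ε + ε) →
      (u ∈ c₁.F i ↔ u ∈ c₂.F i)) :
    LoopConfig.IsClose ε c₁ c' ↔ LoopConfig.IsClose ε c₂ c' :=
  ⟨LoopConfig.IsClose.of_forall_mem_iff hε h,
    LoopConfig.IsClose.of_forall_mem_iff hε fun i u hu ↦ (h i u hu).symm⟩

/-! ### Whole-plane versus restricted configuration: interface loops inside a ball -/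

/-- The trace of the unbased loop of a closed honeycomb walk drawn at mesh `δ` is the trace of its
polyline (definitional bookkeeping). [folklore] -/
theorem range_mk_siteLoopCurve (δ : ℝ) {f : HexVertex} (γ : hexGraph.Walk f f) :
    (UnbasedLoop.mk (BasedLoop.mk (siteLoopCurve δ γ) (isLoop_siteLoopCurve δ γ))).range =
      Set.range (γ.toCurve fun v ↦ (δ : ℂ) * hexCenter v) :=
  rfl

/-- The sites read by a dart of an interface loop are close to the loop: if the polyline of `γ` at
mesh `δ ≥ 0` lies in `B(0, r)` and `e = (x, y)` is a dart of `𝕋` whose left and right faces are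
the head and the tail of a dart of `γ`, then the mesh points `δ x`, `δ y` lie in `B(0, r + δ)`
(both faces have `x` and `y` as vertices, so their centres are within `δ` of `δ x` and `δ y`:
`hexCenter_triEdgeFaces_mem_closedBall`, `triEdgeFaces_symm_holds`) (Camia–Newman 2006, §4: the
boundary of a cluster runs along the edges of its hexagons). [cite: CamiaNewman2006, §4] -/
theorem triMeshPoint_mem_ball_of_mem_darts {δ r : ℝ} (hδ : 0 ≤ δ) {f : HexVertex}
    {γ : hexGraph.Walk f f} (hr : Set.range (γ.toCurve fun v ↦ (δ : ℂ) * hexCenter v) ⊆ ball (0 : ℂ) r)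
    {d : hexGraph.Dart} (hd : d ∈ γ.darts) {e : triGraph.Dart} (he : triEdgeFaces e = (d.snd, d.fst)) :
    triMeshPoint δ e.fst ∈ ball (0 : ℂ) (r + δ) ∧ triMeshPoint δ e.snd ∈ ball (0 : ℂ) (r + δ) := by
  have hc : (δ : ℂ) * hexCenter d.fst ∈ ball (0 : ℂ) r :=
    hr (SimpleGraph.Walk.mem_range_toCurve _ γ (γ.dart_fst_mem_support_of_mem_darts hd))
  rw [mem_ball_zero_iff] at hc
  have key : ∀ {p : ℂ}, (δ : ℂ) * hexCenter d.fst ∈ closedBall p δ → p ∈ ball (0 : ℂ) (r + δ) := by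
    intro p hp
    rw [mem_closedBall, dist_comm, dist_eq_norm] at hp
    rw [mem_ball_zero_iff]
    calc ‖p‖ = ‖p - δ * hexCenter d.fst + δ * hexCenter d.fst‖ := by rw [sub_add_cancel]
      _ ≤ ‖p - δ * hexCenter d.fst‖ + ‖(δ : ℂ) * hexCenter d.fst‖ := norm_add_le _ _
      _ < δ + r := add_lt_add_of_le_of_lt hp hc
      _ = r + δ := add_comm _ _
  constructor
  · have h2 := (hexCenter_triEdgeFaces_mem_closedBall hδ e).2
    rw [he] at h2
    exact key h2
  · have hs : triEdgeFaces e.symm = (d.fst, d.snd) := by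
      rw [triEdgeFaces_symm_holds e, he, Prod.swap_prod_mk]
    have h1 := (hexCenter_triEdgeFaces_mem_closedBall hδ e.symm).1
    rw [hs] at h1
    exact key h1

/-- **Interface loops inside a ball do not see the boundary condition** (Camia–Newman 2006, §6,
proof of Thm 6: configurations coupled to agree on `𝔻_R` have identical boundaries inside
`D ⊂ 𝔻_R`). If the polyline of the closed honeycomb walk `γ` at mesh `δ ≥ 0` lies in `B(0, r)`
and `Ω ⊇ B(0, r + δ)`, then `γ` is an interface loop of the restricted configuration
`ω ∩ triMeshVertices Ω δ` (all sites with mesh point outside `Ω` closed) iff it is an interface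
loop of `ω`: every site read by `γ` has its mesh point in `B(0, r + δ) ⊆ Ω`
(`triMeshPoint_mem_ball_of_mem_darts`). [cite: CamiaNewman2006, §6 (proof of Thm 6)] -/
theorem isSiteInterfaceLoop_inter_triMeshVertices_iff {Ω : Set ℂ} {δ r : ℝ} (hδ : 0 ≤ δ)
    (hΩ : ball (0 : ℂ) (r + δ) ⊆ Ω) {ω : SiteConfig (Site 2)} {f : HexVertex}
    {γ : hexGraph.Walk f f} (hr : Set.range (γ.toCurve fun v ↦ (δ : ℂ) * hexCenter v) ⊆ ball (0 : ℂ) r) :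
    IsSiteInterfaceLoop (ω ∩ triMeshVertices Ω δ) γ ↔ IsSiteInterfaceLoop ω γ := by
  unfold IsSiteInterfaceLoop
  refine and_congr_right fun _ ↦ forall₂_congr fun d hd ↦ exists_congr fun e ↦
    and_congr_right fun he ↦ ?_
  obtain ⟨h1, h2⟩ := triMeshPoint_mem_ball_of_mem_darts hδ hr hd he
  have m1 : e.fst ∈ triMeshVertices Ω δ := mem_triMeshVertices_iff.2 (hΩ h1)
  have m2 : e.snd ∈ triMeshVertices Ω δ := mem_triMeshVertices_iff.2 (hΩ h2)
  simp only [Set.mem_inter_iff, m1, m2, and_true]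

/-- **Typed loops inside a ball do not see the boundary condition**: for `δ ≥ 0` and
`Ω ⊇ B(0, r + δ)`, an unbased loop with trace in `B(0, r)` is a member of type `i` of the typed
configuration `siteLoopConfig δ (ω ∩ triMeshVertices Ω δ)` of the restricted configuration iff it
is a member of type `i` of `siteLoopConfig δ ω` (Camia–Newman 2006, §6, proof of Thm 6, first
step, in the typed encoding of DKKMO §1.2). [cite: CamiaNewman2006, §6 (proof of Thm 6)] -/
theorem mem_siteLoopConfig_inter_iff {Ω : Set ℂ} {δ r : ℝ} (hδ : 0 ≤ δ)
    (hΩ : ball (0 : ℂ) (r + δ) ⊆ Ω) {ω : SiteConfig (Site 2)} {i : Fin 2} {u : UnbasedLoop ℂ}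
    (hu : u.range ⊆ ball (0 : ℂ) r) :
    u ∈ (siteLoopConfig δ (ω ∩ triMeshVertices Ω δ)).F i ↔ u ∈ (siteLoopConfig δ ω).F i := by
  simp only [mem_siteLoopConfig_iff]
  refine exists₂_congr fun v γ ↦ ⟨?_, ?_⟩
  · rintro ⟨h, ht, rfl⟩
    rw [range_mk_siteLoopCurve] at hu
    exact ⟨(isSiteInterfaceLoop_inter_triMeshVertices_iff hδ hΩ hu).1 h, ht, rfl⟩
  · rintro ⟨h, ht, rfl⟩
    rw [range_mk_siteLoopCurve] at hu
    exact ⟨(isSiteInterfaceLoop_inter_triMeshVertices_iff hδ hΩ hu).2 h, ht, rfl⟩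

/-- **`d_CN(siteLoopConfig δ ω, F') ≤ ε` does not see the boundary condition outside
`B(0, 1/ε + ε + δ)`**: for `δ, ε ≥ 0` and `Ω ⊇ B(0, 1/ε + ε + δ)`, the typed loop configuration
of the restricted configuration `ω ∩ triMeshVertices Ω δ` is `ε`-close to `F'` iff that of `ω` is
(`LoopConfig.isClose_congr_left` with `mem_siteLoopConfig_inter_iff`). This is the first step of
the proof of Camia–Newman's Thm 6 (CMP 268 (2006), §6) in DKKMO's metric. [cite: CamiaNewman2006, §6 (proof of Thm 6)] -/
theorem isClose_siteLoopConfig_inter_iff {Ω : Set ℂ} {δ ε : ℝ} (hδ : 0 ≤ δ) (hε : 0 ≤ ε)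
    (hΩ : ball (0 : ℂ) (1 / ε + ε + δ) ⊆ Ω) (ω : SiteConfig (Site 2)) (c' : LoopConfig ℂ) :
    LoopConfig.IsClose ε (siteLoopConfig δ (ω ∩ triMeshVertices Ω δ)) c' ↔
      LoopConfig.IsClose ε (siteLoopConfig δ ω) c' :=
  LoopConfig.isClose_congr_left hε fun _ _ hu ↦ mem_siteLoopConfig_inter_iff hδ hΩ hu

/-- The exceptional events `{d_CN > ε}` against the whole-plane configuration at mesh
`δ ∈ [0, 1]` and against its restriction to the disc `B(0, 1/ε + ε + 1)` coincide
(`isClose_siteLoopConfig_inter_iff`). [cite: CamiaNewman2006, §6 (proof of Thm 6)] -/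
theorem setOf_not_isClose_siteLoopConfig_inter_eq {Ω' : Type*} (X : Ω' → LoopConfig ℂ) {δ ε : ℝ}
    (hδ : 0 ≤ δ) (hδ₁ : δ ≤ 1) (hε : 0 ≤ ε) :
    {p : SiteConfig (Site 2) × Ω' | ¬ LoopConfig.IsClose ε
        (siteLoopConfig δ (p.1 ∩ triMeshVertices (ball (0 : ℂ) (1 / ε + ε + 1)) δ)) (X p.2)} =
      {p | ¬ LoopConfig.IsClose ε (siteLoopConfig δ p.1) (X p.2)} :=
  Set.ext fun p ↦ not_congr (isClose_siteLoopConfig_inter_iff hδ hε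
    (ball_subset_ball (by linarith)) p.1 (X p.2))

/-! ### The domain form of `IsFullPlaneCNLLaw` -/

/-- **Domain form of "the law of `X` is a full-plane CNL law"** (Camia–Newman 2006, Thm 6 and
its proof, §6: the plane process is determined by, and constructed from, the processes in large
discs). `IsFullPlaneCNLLaw μ X` holds iff for every `ε > 0`, for all small `δ > 0`, there is a
coupling `P` of `P_{1/2}` and `μ` under which the typed loop configuration of the critical site
configuration **restricted to the disc `B(0, 1/ε + ε + 1)`** (sites outside closed, as in
`triLoopCollection`) fails to be `ε`-close to `X` with probability `< ε`. (`→`: a coupling with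
`P[d_CN > ε] < ε` exists as soon as `d_CN < ε`, `LoopConfig.exists_coupling_of_cnLawEDist_lt`, and
the exceptional event is unchanged by the restriction for `δ ≤ 1`,
`setOf_not_isClose_siteLoopConfig_inter_eq`; `←`: `LoopConfig.cnLawEDist_le_of_coupling`.)
[cite: CamiaNewman2006, Thm 6] -/
theorem isFullPlaneCNLLaw_iff_inter {Ω' : Type*} [MeasurableSpace Ω'] {μ : Measure Ω'}
    {X : Ω' → LoopConfig ℂ} :
    IsFullPlaneCNLLaw μ X ↔ ∀ ε : ℝ, 0 < ε → ∀ᶠ δ in 𝓝[>] (0 : ℝ),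
      ∃ P : Measure (SiteConfig (Site 2) × Ω'), P.map Prod.fst = triSitePercolation half ∧
        P.map Prod.snd = μ ∧
          P {p | ¬ LoopConfig.IsClose ε
            (siteLoopConfig δ (p.1 ∩ triMeshVertices (ball (0 : ℂ) (1 / ε + ε + 1)) δ)) (X p.2)} <
              ENNReal.ofReal ε := by
  have hev : ∀ᶠ δ in 𝓝[>] (0 : ℝ), δ ∈ Ioc (0 : ℝ) 1 := Ioc_mem_nhdsGT zero_lt_one
  constructor
  · intro h ε hε
    have hlt : ∀ᶠ δ in 𝓝[>] (0 : ℝ), LoopConfig.cnLawEDist (triSitePercolation half)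
        (siteLoopConfig δ) μ X < ENNReal.ofReal ε := h (Iio_mem_nhds (ENNReal.ofReal_pos.2 hε))
    filter_upwards [hlt, hev] with δ hδ hδ'
    obtain ⟨P, h₁, h₂, hP⟩ := LoopConfig.exists_coupling_of_cnLawEDist_lt hδ
    refine ⟨P, h₁, h₂, ?_⟩
    rwa [setOf_not_isClose_siteLoopConfig_inter_eq X hδ'.1.le hδ'.2 hε.le]
  · intro h
    rw [IsFullPlaneCNLLaw, ENNReal.tendsto_nhds_zero]
    intro ε hε
    rcases eq_or_ne ε ⊤ with rfl | hε'
    · exact Eventually.of_forall fun _ ↦ le_top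
    · have hr : 0 < ε.toReal := ENNReal.toReal_pos hε.ne' hε'
      filter_upwards [h ε.toReal hr, hev] with δ hδ hδ'
      obtain ⟨P, h₁, h₂, hP⟩ := hδ
      rw [setOf_not_isClose_siteLoopConfig_inter_eq X hδ'.1.le hδ'.2 hr.le] at hP
      rw [← ENNReal.ofReal_toReal hε']
      exact LoopConfig.cnLawEDist_le_of_coupling hr P h₁ h₂ hP

end Literature.Probability.Percolation

end
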